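import Summits.CriticalPhenomena.PercolationContinuityZ3.Theorems.PercNearOneGluingNoHeavyLowerTailKnQuestion8AntitheticCrownUniversal
import Summits.CriticalPhenomena.PercolationContinuityZ3.Theorems.PercNearOneGluingNoHeavyLowerTailKnQuestion8AntitheticCrownBridge
import HarnessLib

/-!
# `NoHeavyLowerTail` (crux stmt-CriticalPhenomena-4575), antithetic vdBHK programme: THEOREM CO (crown obstruction) for EVERY finite poset —
# the universal crown certificate of `AntitheticCrownUniversal` turned into a quantified kernel theorem

Support file (seat `prim-ineq-gen-7` gen 47; `--supports stmt-CriticalPhenomena-4575`).  No `sorry`, no definitions.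
Memo: run/shared/lean/prim/prim-ineq-gen-7/FINDING-OBSTRUCTION-g46.md §5, PROOF-CO-g46.md (pencil proof), FINDING-CYCLES-g47.md (this gen).

SETTING (hypothesis style, as in the rest of the programme).  `E` a finite partial order (the poset `P`); `down e` its strict down-sets
(`hdown`); colourings `s : E → Bool` (`true` = red).  The Λ-label `lab s e ∈ {0 = RI, 1 = RN, 2 = BN, 3 = BI}` of `e` in `s` (`hlab`): red and all of
`↓°e` red ↦ `RI`, red otherwise ↦ `RN`, blue and all of `↓°e` blue ↦ `BI`, blue otherwise ↦ `BN`; `leL` is the order of `Λ = {RI, BN} < {RN, BI}` (the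
Boolean relation of the certificate file) and the colouring poset `Ω_P` is the coordinatewise order `le` (`hle`; by g45 §1 / PROOF-CO §0 this is the
explicit order `κ(t) ⊆ κ(s) ∧ κ(s̄) ⊆ κ(t̄) ∧ s ∖ t ⊆ κ(s) ∩ κ(t̄)` of the programme).  The involution `ι` is complementation `s ↦ (e ↦ !s e)`.
* `AntitheticCrownObstruction.crown_obstruction` — **THEOREM CO**: if `a, b, c` are minimal, `x > a, b`, `x ≯ c`, `y > a, c`, `y ≯ b`, `z > b, c`,
  `z ≯ a`, then there are `le`-up-sets `U, H` of colourings with `#(U ∩ H) < #(U ∩ ιH)` — `Ω_P` is NOT antipodal Kleitman.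
PROOF (PROOF-CO-g46 §2–§5, fully formal here).  `U, H` are the pull-backs of the certificate's up-sets of `Λ^6` along the label map of the six elements
(base-4 code `code s = τ (κ s) (ρ s)`, `κ s` = colours of the six, `ρ s` = junk pattern of `J_x = ↓°x ∖ {a,b}`, `J_y`, `J_z`, which avoid the six);
up-sets because `le` is labelwise and the certificate sets are up-closures (`table_f`, `table_g`, transitivity of `leL`); the difference
`#(U ∩ H) − #(U ∩ ιH)` is summed fibrewise over the junk colouring (`Finset.sum_fiberwise_of_maps_to`; each fibre is the 64 colourings of the six,
in bijection with `κ < 64`, giving the certificate's `D (ρ j)`), the junk colourings are paired with their complements (`ρ ↦ sw ρ`), and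
`dtilde_nonpos` / `dtilde_strict` (the all-red junk colouring has `ρ &&& 21 = 21`) give `2Δ ≤ −1`.
-/

namespace Summit.CriticalPhenomena.PercolationContinuityZ3.Theorems

open Finset

namespace AntitheticCrownObstruction

variable {E : Type*} [Fintype E] [DecidableEq E] [PartialOrder E]

/-- **THEOREM CO (crown obstruction).**  Let `P` be a finite poset with minimal elements `a, b, c` and elements `x > a, b` (`x ≯ c`),
`y > a, c` (`y ≯ b`), `z > b, c` (`z ≯ a`).  Colourings `s : P → Bool` (`true` = red) carry Λ-labels (`lab s e ∈ {0 = RI, 1 = RN, 2 = BN, 3 = BI}`: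
red & all of `↓°e` red / red otherwise / blue & all of `↓°e` blue gives `3` / blue otherwise `2`) and the colouring poset `Ω_P` is the coordinatewise
Λ-order `le`.  Then `Ω_P` is NOT antipodal Kleitman: there are up-sets `U, H` with `#(U ∩ H) < #(U ∩ ιH)`, `ι` = complementation.
[this work: FINDING-OBSTRUCTION-g46.md §5, PROOF-CO-g46.md; certificate `AntitheticCrownUniversal`] -/
theorem crown_obstruction
    (down : E → Finset E) (hdown : ∀ d e, d ∈ down e ↔ d < e)
    (lab : (E → Bool) → E → ℕ)
    (hlab : ∀ s e, lab s e = if s e = true then (if ∀ d ∈ down e, s d = true then 0 else 1)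
      else (if ∀ d ∈ down e, s d = false then 3 else 2))
    (leL : ℕ → ℕ → Bool)
    (hleL : leL = fun p q => p == q || (p == 0 && q == 1) || (p == 0 && q == 3) || (p == 2 && q == 1) || (p == 2 && q == 3))
    (le : (E → Bool) → (E → Bool) → Prop) (hle : ∀ s t, le s t ↔ ∀ e, leL (lab s e) (lab t e) = true)
    (a b c x y z : E) (ha : ∀ d, ¬ d < a) (hb : ∀ d, ¬ d < b) (hc : ∀ d, ¬ d < c)
    (hax : a < x) (hbx : b < x) (hcx : ¬ c < x) (hay : a < y) (hcy : c < y) (hby : ¬ b < y)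
    (hbz : b < z) (hcz : c < z) (haz : ¬ a < z) :
    ∃ U H : Finset (E → Bool), (∀ s t, le s t → s ∈ U → t ∈ U) ∧ (∀ s t, le s t → s ∈ H → t ∈ H) ∧
      (U ∩ H).card < (U ∩ H.image (fun s => fun e => !s e)).card := by
  classical
  -- ### the finite data of the certificate
  set enc6 : Bool → Bool → Bool → Bool → Bool → Bool → ℕ := fun p0 p1 p2 p3 p4 p5 => (if p0 then 1 else 0) + (if p1 then 2 else 0) +
    (if p2 then 4 else 0) + (if p3 then 8 else 0) + (if p4 then 16 else 0) + (if p5 then 32 else 0) with henc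
  set labC : Bool → Bool → Bool → Bool → Bool → ℕ := fun own p q rj bj => if own then (if p && q && rj then 0 else 1)
    else (if !p && !q && bj then 3 else 2) with hlabC
  set τ : ℕ → ℕ → ℕ := fun κ ρ =>
      (if κ.testBit 0 then 0 else 3) + 4 * (if κ.testBit 1 then 0 else 3) + 16 * (if κ.testBit 2 then 0 else 3) +
      64 * labC (κ.testBit 3) (κ.testBit 0) (κ.testBit 1) (ρ.testBit 0) (ρ.testBit 1) +
      256 * labC (κ.testBit 4) (κ.testBit 0) (κ.testBit 2) (ρ.testBit 2) (ρ.testBit 3) +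
      1024 * labC (κ.testBit 5) (κ.testBit 1) (κ.testBit 2) (ρ.testBit 4) (ρ.testBit 5) with hτ
  set sw : ℕ → ℕ := fun ρ => ((ρ &&& 21) <<< 1) ||| ((ρ &&& 42) >>> 1) with hsw
  set le6 : ℕ → ℕ → Bool := fun m t => (List.range 6).all fun i => leL ((m >>> (2 * i)) &&& 3) ((t >>> (2 * i)) &&& 3) with hle6
  set fU : ℕ → Bool := fun t => [128, 2432, 1664, 2188, 643, 2767].any fun m => le6 m t with hfU
  set gH : ℕ → Bool := fun t => [2624, 2608, 3772, 2995].any fun m => le6 m t with hgH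
  set ft : ℕ → Bool := fun t => ([0, 12734772374285299899, 12734772374285299899, 12734772374285299899, 0, 12734772374285299899, 12734772374285299899, 12734772374285299899, 0, 
        9261652635843854472, 9261652635843854472, 9261652635843854472, 0, 12734772374285299899, 12734772374285299899, 12734772374285299899, 0, 
        12734772374285299899, 12734772374285299899, 12734772374285299899, 0, 12734772374285299899, 12734772374285299899, 12734772374285299899, 0, 
        12734772374285299899, 12734772374285299899, 12734772374285299899, 0, 12734772374285299899, 12734772374285299899, 12734772374285299899, 0, 
        12682136553628151808, 12682136553628151808, 12682136553628151808, 0, 12734772374285299899, 12734772374285299899, 12734772374285299899, 0, 0, 0, 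
        9223372039002292224, 0, 12682136553628151808, 12682136553628151808, 12682136553628151808, 0, 12734772374285299899, 12734772374285299899, 
        12734772374285299899, 0, 12734772374285299899, 12734772374285299899, 12734772374285299899, 0, 9261652635843854472, 9261652635843854472, 
        9261652635843854472, 0, 12734772374285299899, 12734772374285299899, 12734772374285299899].getD (t / 64) 0).testBit (t % 64) with hft
  set gt : ℕ → Bool := fun t => ([0, 0, 0, 0, 0, 0, 0, 0, 0, 0, 0, 0, 0, 0, 0, 0, 0, 0, 0, 0, 12734772371320209408, 12734772374285299899, 0, 12734772371320209408, 
        12734772371320209408, 12734772374285299899, 0, 12734772371320209408, 12734772371320209408, 12734772374285299899, 9261652633687425024, 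
        12734772371320209408, 0, 0, 0, 0, 12734772371320209408, 12734772374285299899, 0, 12734772371320209408, 12734772371320209408, 12734772374285299899, 0, 
        12734772371320209408, 12734772371320209408, 12734772374285299899, 9261652633687425024, 12734772371320209408, 0, 0, 0, 0, 12734772371320209408, 
        12734772374285299899, 12682136550675316736, 12734772371320209408, 12734772371320209408, 12734772374285299899, 12682136550675316736, 
        12734772371320209408, 12734772371320209408, 12734772374285299899, 12720417147507965952, 12734772371320209408].getD (t / 64) 0).testBit (t % 64) with hgt
  set D : ℕ → ℤ := fun ρ => ((List.range 64).map fun κ =>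
      if ft (τ κ ρ) then ((if gt (τ κ ρ) then (1 : ℤ) else 0) - (if gt (4095 - τ κ ρ) then (1 : ℤ) else 0)) else 0).sum with hD
  have htabf := AntitheticCrownUniversal.table_f leL hleL le6 hle6 fU hfU ft hft
  have htabg := AntitheticCrownUniversal.table_g leL hleL le6 hle6 gH hgH gt hgt
  have hnonpos := AntitheticCrownUniversal.dtilde_nonpos ft hft gt hgt labC hlabC τ hτ D hD sw hsw
  have hstrict := AntitheticCrownUniversal.dtilde_strict ft hft gt hgt labC hlabC τ hτ D hD sw hsw
  -- ### distinctness of the six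
  have hab : a ≠ b := fun h => hby (h ▸ hay); have hac : a ≠ c := fun h => hcx (h ▸ hax); have hbc : b ≠ c := fun h => hcx (h ▸ hbx)
  have hxa : x ≠ a := fun h => lt_irrefl a (h ▸ hax); have hxb : x ≠ b := fun h => lt_irrefl b (h ▸ hbx)
  have hxc : x ≠ c := fun h => hc a (h ▸ hax); have hya : y ≠ a := fun h => lt_irrefl a (h ▸ hay)
  have hyb : y ≠ b := fun h => hb a (h ▸ hay); have hyc : y ≠ c := fun h => lt_irrefl c (h ▸ hcy)
  have hza : z ≠ a := fun h => ha b (h ▸ hbz); have hzb : z ≠ b := fun h => lt_irrefl b (h ▸ hbz)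
  have hzc : z ≠ c := fun h => lt_irrefl c (h ▸ hcz); have hxy : x ≠ y := fun h => hby (h ▸ hbx)
  have hxz : x ≠ z := fun h => haz (h ▸ hax); have hyz : y ≠ z := fun h => haz (h ▸ hay)
  -- ### junk sets and encodings of a colouring
  set Jx : Finset E := (down x).filter (fun d => d ≠ a ∧ d ≠ b) with hJx
  set Jy : Finset E := (down y).filter (fun d => d ≠ a ∧ d ≠ c) with hJy
  set Jz : Finset E := (down z).filter (fun d => d ≠ b ∧ d ≠ c) with hJz
  set κ : (E → Bool) → ℕ := fun s => enc6 (s a) (s b) (s c) (s x) (s y) (s z) with hκ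
  set ρ : (E → Bool) → ℕ := fun s => enc6 (decide (∀ d ∈ Jx, s d = true)) (decide (∀ d ∈ Jx, s d = false))
      (decide (∀ d ∈ Jy, s d = true)) (decide (∀ d ∈ Jy, s d = false)) (decide (∀ d ∈ Jz, s d = true)) (decide (∀ d ∈ Jz, s d = false)) with hρ
  set code : (E → Bool) → ℕ := fun s => τ (κ s) (ρ s) with hcode
  set cpl : (E → Bool) → (E → Bool) := fun s => fun e => !s e with hcpl
  have hcplcpl : ∀ s, cpl (cpl s) = s := by intro s; funext e; simp [hcpl]
  -- ### labels: atoms and the three maxima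
  have hlabC_lt : ∀ own p q rj bj, labC own p q rj bj < 4 := AntitheticCrownBridge.lab_lt labC hlabC
  have hlab_lt : ∀ s e, lab s e < 4 := by
    intro s e; rw [hlab]; split_ifs <;> omega
  have hlab_atom : ∀ s e, (∀ d, ¬ d < e) → lab s e = if s e = true then 0 else 3 := by
    intro s e he
    rw [hlab, if_pos (fun d hd => (he d ((hdown d e).1 hd)).elim), if_pos (fun d hd => (he d ((hdown d e).1 hd)).elim)]
  have hdown_split : ∀ (w p q : E) (J : Finset E), p < w → q < w → J = (down w).filter (fun d => d ≠ p ∧ d ≠ q) →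
      ∀ (s : E → Bool) (v : Bool), (∀ d ∈ down w, s d = v) ↔ (s p = v ∧ s q = v ∧ ∀ d ∈ J, s d = v) := by
    intro w p q J hp hq hJ s v
    constructor
    · intro h
      refine ⟨h p ((hdown p w).2 hp), h q ((hdown q w).2 hq), fun d hd => h d ?_⟩
      rw [hJ] at hd; exact (Finset.mem_filter.1 hd).1
    · rintro ⟨h1, h2, h3⟩ d hd
      by_cases hdp : d = p; · rw [hdp]; exact h1
      by_cases hdq : d = q; · rw [hdq]; exact h2
      exact h3 d (by rw [hJ]; exact Finset.mem_filter.2 ⟨hd, hdp, hdq⟩)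
  have hlab_max : ∀ (w p q : E) (J : Finset E), p < w → q < w → J = (down w).filter (fun d => d ≠ p ∧ d ≠ q) →
      ∀ s, lab s w = labC (s w) (s p) (s q) (decide (∀ d ∈ J, s d = true)) (decide (∀ d ∈ J, s d = false)) := by
    intro w p q J hp hq hJ s
    have e1 := hdown_split w p q J hp hq hJ s true
    have e2 := hdown_split w p q J hp hq hJ s false
    rw [hlab, hlabC]
    dsimp only
    rw [if_congr e1 rfl rfl, if_congr e2 rfl rfl]
    cases s w <;> cases s p <;> cases s q <;> by_cases hJ1 : (∀ d ∈ J, s d = true) <;> by_cases hJ2 : (∀ d ∈ J, s d = false) <;>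
      simp [hJ1, hJ2]
  have hlx := hlab_max x a b Jx hax hbx hJx
  have hly := hlab_max y a c Jy hay hcy hJy
  have hlz := hlab_max z b c Jz hbz hcz hJz
  have hla : ∀ s, lab s a = if s a = true then 0 else 3 := fun s => hlab_atom s a ha
  have hlb : ∀ s, lab s b = if s b = true then 0 else 3 := fun s => hlab_atom s b hb
  have hlc : ∀ s, lab s c = if s c = true then 0 else 3 := fun s => hlab_atom s c hc
  -- ### bits of the encodings
  have hbits := AntitheticCrownBridge.enc6_testBit enc6 henc
  have hκbits : ∀ s, (κ s).testBit 0 = s a ∧ (κ s).testBit 1 = s b ∧ (κ s).testBit 2 = s c ∧ (κ s).testBit 3 = s x ∧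
      (κ s).testBit 4 = s y ∧ (κ s).testBit 5 = s z ∧ κ s < 64 := fun s => hbits (s a) (s b) (s c) (s x) (s y) (s z)
  have hρbits : ∀ s, (ρ s).testBit 0 = decide (∀ d ∈ Jx, s d = true) ∧ (ρ s).testBit 1 = decide (∀ d ∈ Jx, s d = false) ∧
      (ρ s).testBit 2 = decide (∀ d ∈ Jy, s d = true) ∧ (ρ s).testBit 3 = decide (∀ d ∈ Jy, s d = false) ∧
      (ρ s).testBit 4 = decide (∀ d ∈ Jz, s d = true) ∧ (ρ s).testBit 5 = decide (∀ d ∈ Jz, s d = false) ∧ ρ s < 64 :=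
    fun s => hbits _ _ _ _ _ _
  -- ### the code of a colouring is the base-4 number of its six labels
  have hcode_eq : ∀ s, code s = lab s a + 4 * lab s b + 16 * lab s c + 64 * lab s x + 256 * lab s y + 1024 * lab s z := by
    intro s
    obtain ⟨k0, k1, k2, k3, k4, k5, -⟩ := hκbits s; obtain ⟨r0, r1, r2, r3, r4, r5, -⟩ := hρbits s
    have : code s = τ (κ s) (ρ s) := rfl
    rw [this, hτ]; dsimp only
    rw [k0, k1, k2, k3, k4, k5, r0, r1, r2, r3, r4, r5, hla s, hlb s, hlc s, hlx s, hly s, hlz s]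
  have hcode_lt : ∀ s, code s < 4096 := by
    intro s; rw [hcode_eq s]
    exact AntitheticCrownBridge.sum_lt_4096 (hlab_lt s a) (hlab_lt s b) (hlab_lt s c) (hlab_lt s x) (hlab_lt s y) (hlab_lt s z)
  -- digits of the code
  have hdig : ∀ s, ((code s >>> (2 * 0)) &&& 3 = lab s a) ∧ ((code s >>> (2 * 1)) &&& 3 = lab s b) ∧ ((code s >>> (2 * 2)) &&& 3 = lab s c) ∧
      ((code s >>> (2 * 3)) &&& 3 = lab s x) ∧ ((code s >>> (2 * 4)) &&& 3 = lab s y) ∧ ((code s >>> (2 * 5)) &&& 3 = lab s z) := by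
    intro s
    rw [hcode_eq s]
    exact AntitheticCrownBridge.digit_of_sum ⟨lab s a, hlab_lt s a⟩ ⟨lab s b, hlab_lt s b⟩ ⟨lab s c, hlab_lt s c⟩
      ⟨lab s x, hlab_lt s x⟩ ⟨lab s y, hlab_lt s y⟩ ⟨lab s z, hlab_lt s z⟩
  -- ### le6 and monotonicity of the pulled-back sets
  have hle6_iff : ∀ u v, le6 u v = true ↔ ∀ i, i < 6 → leL ((u >>> (2 * i)) &&& 3) ((v >>> (2 * i)) &&& 3) = true := by
    intro u v; rw [hle6]; simp [List.all_eq_true, List.mem_range]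
  have hdigit_lt : ∀ (u i : ℕ), (u >>> (2 * i)) &&& 3 < 4 := by
    intro u i
    have := @Nat.and_le_right (u >>> (2 * i)) 3
    omega
  have hle6_code : ∀ s t, le s t → le6 (code s) (code t) = true := by
    intro s t hst
    rw [hle] at hst
    rw [hle6_iff]
    intro i hi
    obtain ⟨d0, d1, d2, d3, d4, d5⟩ := hdig s
    obtain ⟨e0, e1, e2, e3, e4, e5⟩ := hdig t
    interval_cases i
    exacts [by rw [d0, e0]; exact hst a, by rw [d1, e1]; exact hst b, by rw [d2, e2]; exact hst c,
      by rw [d3, e3]; exact hst x, by rw [d4, e4]; exact hst y, by rw [d5, e5]; exact hst z]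
  have hle6_trans : ∀ m u v, le6 m u = true → le6 u v = true → le6 m v = true := by
    intro m u v h1 h2
    rw [hle6_iff] at h1 h2 ⊢
    intro i hi
    exact AntitheticCrownBridge.leL_trans leL hleL (hdigit_lt m i) (hdigit_lt u i) (hdigit_lt v i) (h1 i hi) (h2 i hi)
  have hft_mono : ∀ s t, le s t → ft (code s) = true → ft (code t) = true := by
    intro s t hst hs
    have e1 := htabf ⟨code s, hcode_lt s⟩; have e2 := htabf ⟨code t, hcode_lt t⟩
    simp only at e1 e2; rw [e1, hfU] at hs; rw [e2, hfU]; simp only [List.any_eq_true] at hs ⊢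
    obtain ⟨m, hm, hml⟩ := hs; exact ⟨m, hm, hle6_trans m _ _ hml (hle6_code s t hst)⟩
  have hgt_mono : ∀ s t, le s t → gt (code s) = true → gt (code t) = true := by
    intro s t hst hs
    have e1 := htabg ⟨code s, hcode_lt s⟩; have e2 := htabg ⟨code t, hcode_lt t⟩
    simp only at e1 e2; rw [e1, hgH] at hs; rw [e2, hgH]; simp only [List.any_eq_true] at hs ⊢
    obtain ⟨m, hm, hml⟩ := hs; exact ⟨m, hm, hle6_trans m _ _ hml (hle6_code s t hst)⟩
  -- ### the two up-sets
  refine ⟨Finset.univ.filter (fun s => ft (code s) = true), Finset.univ.filter (fun s => gt (code s) = true), ?_, ?_, ?_⟩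
  · intro s t hst hs; simp only [Finset.mem_filter, Finset.mem_univ, true_and] at hs ⊢; exact hft_mono s t hst hs
  · intro s t hst hs; simp only [Finset.mem_filter, Finset.mem_univ, true_and] at hs ⊢; exact hgt_mono s t hst hs
  -- ### counting: Δ = Σ_s F s
  set U : Finset (E → Bool) := Finset.univ.filter (fun s => ft (code s) = true) with hU
  set H : Finset (E → Bool) := Finset.univ.filter (fun s => gt (code s) = true) with hH
  have hmem_img : ∀ s, s ∈ H.image (fun s => fun e => !s e) ↔ gt (code (cpl s)) = true := by
    intro s
    constructor
    · intro h
      obtain ⟨t, ht, rfl⟩ := Finset.mem_image.1 h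
      have : cpl (fun e => !t e) = t := hcplcpl t
      rw [this]; simpa [hH] using ht
    · intro h
      exact Finset.mem_image.2 ⟨cpl s, by simpa [hH] using h, hcplcpl s⟩
  have hUH : (U ∩ H) = Finset.univ.filter (fun s => ft (code s) = true ∧ gt (code s) = true) := by
    ext s; simp [hU, hH, Finset.mem_inter]
  have hUiH : (U ∩ H.image (fun s => fun e => !s e)) = Finset.univ.filter (fun s => ft (code s) = true ∧ gt (code (cpl s)) = true) := by
    ext s
    rw [Finset.mem_inter, hmem_img s]
    simp [hU]
  -- complement of a colouring in code
  have hκcpl : ∀ s, κ (cpl s) = 63 - κ s := fun s => AntitheticCrownBridge.enc6_compl enc6 henc (s a) (s b) (s c) (s x) (s y) (s z)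
  have hρcpl : ∀ s, ρ (cpl s) = sw (ρ s) := by
    intro s
    have hsw6 := AntitheticCrownBridge.enc6_swap enc6 henc sw hsw
    have e1 : ∀ J : Finset E, decide (∀ d ∈ J, cpl s d = true) = decide (∀ d ∈ J, s d = false) := by
      intro J; congr 1; simp [hcpl]
    have e2 : ∀ J : Finset E, decide (∀ d ∈ J, cpl s d = false) = decide (∀ d ∈ J, s d = true) := by
      intro J; congr 1; simp [hcpl]
    show enc6 _ _ _ _ _ _ = sw (enc6 _ _ _ _ _ _)
    rw [hsw6, e1, e2, e1, e2, e1, e2]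
  have hcode_cpl : ∀ s, code (cpl s) = 4095 - code s := by
    intro s
    have := AntitheticCrownBridge.tau_compl labC hlabC τ hτ sw hsw ⟨κ s, (hκbits s).2.2.2.2.2.2⟩ ⟨ρ s, (hρbits s).2.2.2.2.2.2⟩
    simp only at this
    show τ (κ (cpl s)) (ρ (cpl s)) = 4095 - τ (κ s) (ρ s)
    rw [hκcpl, hρcpl, this]
  -- the summand
  set G : ℕ → ℕ → ℤ := fun k r => if ft (τ k r) = true then ((if gt (τ k r) = true then (1 : ℤ) else 0) - (if gt (4095 - τ k r) = true then (1 : ℤ) else 0))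
    else 0 with hG
  have hΔ : ((U ∩ H).card : ℤ) - ((U ∩ H.image (fun s => fun e => !s e)).card : ℤ) = ∑ s, G (κ s) (ρ s) := by
    rw [hUH, hUiH, Finset.card_filter, Finset.card_filter]
    push_cast
    rw [← Finset.sum_sub_distrib]
    refine Finset.sum_congr rfl (fun s _ => ?_)
    have ec : τ (κ s) (ρ s) = code s := rfl
    have e' : 4095 - code s = code (cpl s) := (hcode_cpl s).symm
    rw [hG]; dsimp only
    rw [ec, e']
    by_cases h1 : ft (code s) = true <;> by_cases h2 : gt (code s) = true <;> by_cases h3 : gt (code (cpl s)) = true <;> simp [h1, h2, h3]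
  -- ### fibrewise over the junk colouring
  set six : Finset E := {a, b, c, x, y, z} with hsix
  set rj : (E → Bool) → (E → Bool) := fun s => fun e => if e ∈ six then true else s e with hrj
  have hmem_six : ∀ e, e ∈ six ↔ e = a ∨ e = b ∨ e = c ∨ e = x ∨ e = y ∨ e = z := by
    intro e; simp [hsix]
  have hJ_disj : ∀ d, (d ∈ Jx ∨ d ∈ Jy ∨ d ∈ Jz) → d ∉ six := by
    intro d hd hds
    rw [hmem_six] at hds
    have hyx : ¬ y < x := fun h => hcx (lt_trans hcy h); have hzx : ¬ z < x := fun h => hcx (lt_trans hcz h)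
    have hxy' : ¬ x < y := fun h => hby (lt_trans hbx h); have hzy : ¬ z < y := fun h => hby (lt_trans hbz h)
    have hxz' : ¬ x < z := fun h => haz (lt_trans hax h); have hyz' : ¬ y < z := fun h => haz (lt_trans hay h)
    rcases hd with hd | hd | hd
    · rw [hJx, Finset.mem_filter, hdown] at hd; obtain ⟨hd, hd1, hd2⟩ := hd
      rcases hds with rfl | rfl | rfl | rfl | rfl | rfl
      exacts [hd1 rfl, hd2 rfl, hcx hd, lt_irrefl _ hd, hyx hd, hzx hd]
    · rw [hJy, Finset.mem_filter, hdown] at hd; obtain ⟨hd, hd1, hd2⟩ := hd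
      rcases hds with rfl | rfl | rfl | rfl | rfl | rfl
      exacts [hd1 rfl, hby hd, hd2 rfl, hxy' hd, lt_irrefl _ hd, hzy hd]
    · rw [hJz, Finset.mem_filter, hdown] at hd; obtain ⟨hd, hd1, hd2⟩ := hd
      rcases hds with rfl | rfl | rfl | rfl | rfl | rfl
      exacts [haz hd, hd1 rfl, hd2 rfl, hxz' hd, hyz' hd, lt_irrefl _ hd]
  -- ρ depends only on the junk coordinates
  have hρ_congr : ∀ s t : E → Bool, (∀ e, e ∉ six → s e = t e) → ρ s = ρ t := by
    intro s t hst
    have ex : ∀ (J : Finset E), (∀ d, d ∈ J → d ∉ six) → ∀ v : Bool, decide (∀ d ∈ J, s d = v) = decide (∀ d ∈ J, t d = v) := by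
      intro J hJ v; congr 1
      exact propext ⟨fun h d hd => (hst d (hJ d hd)) ▸ h d hd, fun h d hd => (hst d (hJ d hd)).symm ▸ h d hd⟩
    have e1 := ex Jx (fun d hd => hJ_disj d (Or.inl hd))
    have e2 := ex Jy (fun d hd => hJ_disj d (Or.inr (Or.inl hd)))
    have e3 := ex Jz (fun d hd => hJ_disj d (Or.inr (Or.inr hd)))
    show enc6 _ _ _ _ _ _ = enc6 _ _ _ _ _ _
    rw [e1, e1, e2, e2, e3, e3]
  have hρ_rj : ∀ s, ρ (rj s) = ρ s := by
    intro s; apply hρ_congr; intro e he; simp [hrj, he]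
  -- the fibre bijection
  set ext : (E → Bool) → ℕ → (E → Bool) := fun j k => fun e =>
    if e = a then k.testBit 0 else if e = b then k.testBit 1 else if e = c then k.testBit 2 else
    if e = x then k.testBit 3 else if e = y then k.testBit 4 else if e = z then k.testBit 5 else j e with hext
  have hext_a : ∀ j k, ext j k a = k.testBit 0 := by intro j k; simp [hext]
  have hext_b : ∀ j k, ext j k b = k.testBit 1 := by intro j k; simp [hext, hab.symm]
  have hext_c : ∀ j k, ext j k c = k.testBit 2 := by intro j k; simp [hext, hac.symm, hbc.symm]
  have hext_x : ∀ j k, ext j k x = k.testBit 3 := by intro j k; simp [hext, hxa, hxb, hxc]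
  have hext_y : ∀ j k, ext j k y = k.testBit 4 := by intro j k; simp [hext, hya, hyb, hyc, hxy.symm]
  have hext_z : ∀ j k, ext j k z = k.testBit 5 := by intro j k; simp [hext, hza, hzb, hzc, hxz.symm, hyz.symm]
  have hext_off : ∀ j k e, e ∉ six → ext j k e = j e := by
    intro j k e he
    rw [hmem_six] at he; push Not at he
    obtain ⟨h1, h2, h3, h4, h5, h6⟩ := he
    simp [hext, h1, h2, h3, h4, h5, h6]
  have hDsum : ∀ r, D r = ∑ k ∈ Finset.range 64, G k r := by
    intro r
    rw [hD, Finset.sum_eq_multiset_sum, Finset.range_val, ← Multiset.coe_range, Multiset.map_coe, Multiset.sum_coe]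
  have hfibre : ∀ j ∈ (Finset.univ : Finset (E → Bool)).image rj,
      ∑ s ∈ Finset.univ.filter (fun s => rj s = j), G (κ s) (ρ s) = D (ρ j) := by
    intro j hj
    obtain ⟨s0, -, hs0⟩ := Finset.mem_image.1 hj
    have hjsix : ∀ e, e ∈ six → j e = true := by
      intro e he; rw [← hs0]; simp [hrj, he]
    rw [hDsum]
    refine Finset.sum_nbij' (fun s => κ s) (fun k => ext j k) ?_ ?_ ?_ ?_ ?_
    · intro s hs
      exact Finset.mem_range.2 (hκbits s).2.2.2.2.2.2
    · intro k hk
      simp only [Finset.mem_filter, Finset.mem_univ, true_and]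
      funext e
      by_cases he : e ∈ six
      · simp only [hrj, he, if_true, hjsix e he]
      · simp only [hrj, he, if_false]; exact hext_off j k e he
    · intro s hs
      simp only [Finset.mem_filter, Finset.mem_univ, true_and] at hs
      obtain ⟨k0, k1, k2, k3, k4, k5, -⟩ := hκbits s
      funext e
      by_cases he : e ∈ six
      · rw [hmem_six] at he
        rcases he with rfl | rfl | rfl | rfl | rfl | rfl
        exacts [by rw [hext_a, k0], by rw [hext_b, k1], by rw [hext_c, k2], by rw [hext_x, k3], by rw [hext_y, k4], by rw [hext_z, k5]]
      · rw [hext_off j _ e he, ← hs]; simp [hrj, he]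
    · intro k hk
      have hk64 : k < 64 := Finset.mem_range.1 hk
      have := AntitheticCrownBridge.enc6_of_testBit enc6 henc ⟨k, hk64⟩
      simp only at this
      show enc6 (ext j k a) (ext j k b) (ext j k c) (ext j k x) (ext j k y) (ext j k z) = k
      rw [hext_a, hext_b, hext_c, hext_x, hext_y, hext_z, this]
    · intro s hs
      simp only [Finset.mem_filter, Finset.mem_univ, true_and] at hs
      show G (κ s) (ρ s) = G (κ s) (ρ j)
      rw [← hs, hρ_rj]
  have hΔ2 : ∑ s, G (κ s) (ρ s) = ∑ j ∈ (Finset.univ : Finset (E → Bool)).image rj, D (ρ j) := by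
    rw [← Finset.sum_fiberwise_of_maps_to (s := Finset.univ) (t := (Finset.univ : Finset (E → Bool)).image rj) (g := rj)
      (fun s _ => Finset.mem_image_of_mem rj (Finset.mem_univ s))]
    exact Finset.sum_congr rfl hfibre
  -- ### pairing j with its junk-complement
  set JS := (Finset.univ : Finset (E → Bool)).image rj with hJS
  set cj : (E → Bool) → (E → Bool) := fun j => rj (cpl j) with hcj
  have hcj_mem : ∀ j ∈ JS, cj j ∈ JS := fun j _ => Finset.mem_image_of_mem rj (Finset.mem_univ _)
  have hcj_inv : ∀ j ∈ JS, cj (cj j) = j := by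
    intro j hj
    obtain ⟨s0, -, hs0⟩ := Finset.mem_image.1 hj
    funext e
    by_cases he : e ∈ six
    · rw [← hs0]; simp [hcj, hrj, hcpl, he]
    · simp [hcj, hrj, hcpl, he]
  have hρ_cj : ∀ j, ρ (cj j) = sw (ρ j) := fun j => by show ρ (rj (cpl j)) = sw (ρ j); rw [hρ_rj, hρcpl]
  have hpair : ∑ j ∈ JS, D (ρ j) = ∑ j ∈ JS, D (sw (ρ j)) := by
    have h1 : ∑ j ∈ JS, D (ρ j) = ∑ j ∈ JS, D (ρ (cj j)) :=
      Finset.sum_nbij' cj cj hcj_mem hcj_mem hcj_inv hcj_inv (fun j hj => by rw [hcj_inv j hj])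
    rw [h1]
    exact Finset.sum_congr rfl (fun j _ => by rw [hρ_cj])
  have htwice : 2 * ∑ j ∈ JS, D (ρ j) = ∑ j ∈ JS, (D (ρ j) + D (sw (ρ j))) := by
    rw [two_mul, Finset.sum_add_distrib, ← hpair]
  -- ### the certificate bounds
  have hterm_nonpos : ∀ j, D (ρ j) + D (sw (ρ j)) ≤ 0 := fun j => by simpa using hnonpos ⟨ρ j, (hρbits j).2.2.2.2.2.2⟩
  set j0 : E → Bool := rj (fun _ => true) with hj0
  have hj0_mem : j0 ∈ JS := Finset.mem_image_of_mem rj (Finset.mem_univ _)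
  have hj0_true : ∀ e, j0 e = true := by intro e; simp [hj0, hrj]
  have hρj0 : ρ j0 &&& 21 = 21 := by
    have e1 : ∀ J : Finset E, decide (∀ d ∈ J, j0 d = true) = true := by
      intro J; simp [hj0_true]
    show enc6 _ _ _ _ _ _ &&& 21 = 21
    rw [e1, e1, e1]
    exact AntitheticCrownBridge.enc6_and21 enc6 henc _ _ _
  have hterm_strict : D (ρ j0) + D (sw (ρ j0)) ≤ -1 := by simpa using hstrict ⟨ρ j0, (hρbits j0).2.2.2.2.2.2⟩ hρj0
  have hsum_le : ∑ j ∈ JS, (D (ρ j) + D (sw (ρ j))) ≤ -1 := by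
    rw [← Finset.add_sum_erase JS _ hj0_mem]
    have : ∑ j ∈ JS.erase j0, (D (ρ j) + D (sw (ρ j))) ≤ 0 := Finset.sum_nonpos (fun j _ => hterm_nonpos j)
    linarith
  -- ### conclusion
  have hfinal : ((U ∩ H).card : ℤ) - ((U ∩ H.image (fun s => fun e => !s e)).card : ℤ) ≤ -1 := by
    rw [hΔ, hΔ2]; have := htwice; linarith
  have : ((U ∩ H).card : ℤ) < ((U ∩ H.image (fun s => fun e => !s e)).card : ℤ) := by linarith
  exact_mod_cast this

end AntitheticCrownObstruction

end Summit.CriticalPhenomena.PercolationContinuityZ3.Theorems
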